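import Mathlib.Topology.OpenPartialHomeomorph.Constructions
import Mathlib.Topology.OpenPartialHomeomorph.Composition
import Mathlib.Topology.Algebra.Group.Basic
import Mathlib.Topology.Algebra.ContinuousMonoidHom
import Mathlib.Algebra.Group.Subgroup.Basic
import HarnessLib

/-!
# Slice data at a semisimple point: TRANSPORT along an isomorphism of topological groups
# (N6nsGerm (S1)∕(S2), brick (D1), sub-brick (m1) — the generic plumbing between the field-level slice datum and `G′_v = U(H′)(L⁺_v)`)

Topic `NumberTheory/Automorphic`; namespace `Literature.NumberTheory.Automorphic`. THEOREMS ONLY (no definition, no instance, no notation, no named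
fact, no `sorry`). Cell `pub/hodgecm-mathlib`, programme P3a, road «N6nsGerm» (LEAD F0P3a-plan (g9) T8-60 (B); A-p16 (g26) menu (m1)).

A SLICE DATUM WITH BOX CLAUSE on a topological group `G` around a (possibly singular) semisimple `γ` (the shape delivered by
`UnitarySliceDatum.exists_unitary_sliceDatum`): a subgroup `T ≤ G` (there `T = Z_G(γ)`), a slice `s : A → G`, an
`e : OpenPartialHomeomorph (A × ↥T) G` with `e(a, t) = s(a)·t·s(a)⁻¹` on its source, a base point `(a₀, t₀) ∈ e.source`, and inside every neighbourhood of
`(a₀, t₀)` a compact-open box `K × B₁ ⊆ e.source` with (SAT) `x·t·x⁻¹ ∈ e(K × B₁) ⇒ x ∈ s(K)·T` and (SEP′) `y·t·y⁻¹ = t′` (`t, t′ ∈ B₁`) `⇒ y ∈ T`.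
Compared with the REGULAR chart datum of `ChartDatumProdTransport` the torus factor is already the subgroup `↥T`, there is no regularity conjunct, and
the separation clause concludes `y ∈ T` instead of `b = b′`; so the transport is re-run here once, generically.

* §1 `exists_sliceDatum_map` — along `φ : G ≃ₜ* G′` the datum `(e, s)` on `A × B` (abstract torus coordinate `τ : B → G`, `T ≤ G`) becomes
  `(φ ∘ e, φ ∘ s, φ ∘ τ)` with `T ↦ T′` for any `T′ ≤ G′` with `g ∈ T ↔ φ g ∈ T′` (same source, same boxes).
* §2 `exists_sliceDatum_recoord` — re-coordinatisation of the torus factor along a homeomorphism `κ : B ≃ₜ B′` with `τ′ ∘ κ = τ` (boxes `K × κ(B₁)`).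
* §3 `exists_sliceDatum_transport` — the SUBGROUP form: from a datum on `A × ↥T` to a datum on `A × ↥T′` along `φ` (`κ = φ|_T : ↥T ≃ₜ ↥T′`);
  `exists_sliceDatum_transport_centralizer` — the CENTRALISER form `T = Z_G(γ)`, `T′ = Z_{G′}(γ′)`, `γ′ = φ γ` (the token shape of
  `exists_unitary_sliceDatum`'s conclusion), which the CM dress (D1)-CM applies with `φ := (localNonsplitEquiv …).symm`.

HONEST SCOPE. Point-set topology and group algebra only. HC_CM is proved only modulo the printed citations until rung 0 closes; this file discharges no
printed statement (it is plumbing for the chart half (D1) of Harish-Chandra descent at a singular semisimple point).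

## References
* [HarishChandra1970] Harish-Chandra (notes by G. van Dijk), *Harmonic Analysis on Reductive p-adic Groups*, LNM 162 (1970), Part II §5 (descent to
  `M = Z_G(γ)`; the slice is transported along isomorphisms of the ambient group).
* [Rogawski1990] J. D. Rogawski, *Automorphic Representations of Unitary Groups in Three Variables*, Ann. of Math. Stud. 123 (1990), §8.2 Prop. 8.2.1
  pp. 112–116 (descent at the singular semisimple classes of `U(3)`).
* [BourbakiGT1] N. Bourbaki, *General Topology*, Ch. III §2 (topological groups: isomorphisms, subgroups).
-/

set_option autoImplicit false

open Set Filter Topology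
open scoped Pointwise

namespace Literature.NumberTheory.Automorphic

/-! ## §1 Transport of a slice datum along an isomorphism of topological groups (abstract torus coordinate) -/

section Map

variable {A B G G' : Type*} [TopologicalSpace A] [TopologicalSpace B]
  [Group G] [TopologicalSpace G] [Group G'] [TopologicalSpace G']

/-- **Transport of a slice datum with its box clause along `φ : G ≃ₜ* G′`** (abstract torus coordinate `τ : B → G`). The transported datum is
`e′ = φ ∘ e` (same source), `s′ = φ ∘ s`, `τ′ = φ ∘ τ`; the subgroup `T` may be replaced by any `T′ ≤ G′` with `g ∈ T ↔ φ g ∈ T′`; the boxes are unchanged.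
[cite: BourbakiGT1, Ch. III §2] [cite: HarishChandra1970, Part II §5] -/
theorem exists_sliceDatum_map (φ : G ≃ₜ* G') (T : Subgroup G) (T' : Subgroup G') (hT : ∀ g, g ∈ T ↔ φ g ∈ T')
    (s : A → G) (τ : B → G) (e : OpenPartialHomeomorph (A × B) G) (he : ∀ p ∈ e.source, e p = s p.1 * τ p.2 * (s p.1)⁻¹)
    {a₀ : A} {b₀ : B}
    (hbox : ∀ N ∈ 𝓝 (a₀, b₀), ∃ (K : Set A) (B₁ : Set B), IsCompact K ∧ IsOpen K ∧ a₀ ∈ K ∧ IsCompact B₁ ∧ IsOpen B₁ ∧ b₀ ∈ B₁ ∧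
      K ×ˢ B₁ ⊆ N ∧ K ×ˢ B₁ ⊆ e.source ∧
      (∀ b ∈ B₁, ∀ x : G, x * τ b * x⁻¹ ∈ e '' (K ×ˢ B₁) → x ∈ s '' K * (T : Set G)) ∧
      (∀ b ∈ B₁, ∀ b' ∈ B₁, ∀ y : G, y * τ b * y⁻¹ = τ b' → y ∈ T)) :
    ∃ e' : OpenPartialHomeomorph (A × B) G', e'.source = e.source ∧ (∀ p, e' p = φ (e p)) ∧
      (∀ p ∈ e'.source, e' p = φ (s p.1) * φ (τ p.2) * (φ (s p.1))⁻¹) ∧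
      ∀ N ∈ 𝓝 (a₀, b₀), ∃ (K : Set A) (B₁ : Set B), IsCompact K ∧ IsOpen K ∧ a₀ ∈ K ∧ IsCompact B₁ ∧ IsOpen B₁ ∧ b₀ ∈ B₁ ∧
        K ×ˢ B₁ ⊆ N ∧ K ×ˢ B₁ ⊆ e'.source ∧
        (∀ b ∈ B₁, ∀ x : G', x * φ (τ b) * x⁻¹ ∈ e' '' (K ×ˢ B₁) → x ∈ (fun a => φ (s a)) '' K * (T' : Set G')) ∧
        (∀ b ∈ B₁, ∀ b' ∈ B₁, ∀ y : G', y * φ (τ b) * y⁻¹ = φ (τ b') → y ∈ T') := by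
  refine ⟨e.transHomeomorph φ.toHomeomorph, rfl, fun p => rfl, ?_, ?_⟩
  · intro p hp
    show φ (e p) = _
    rw [he p hp, map_mul, map_mul, map_inv]
  · intro N hN
    obtain ⟨K, B₁, hKc, hKo, haK, hB₁c, hB₁o, hbB, hKBN, hKBs, hsat, hsep⟩ := hbox N hN
    refine ⟨K, B₁, hKc, hKo, haK, hB₁c, hB₁o, hbB, hKBN, hKBs, ?_, ?_⟩
    · intro b hb x hx
      -- pull back along `φ`
      have hx' : φ.symm x * τ b * (φ.symm x)⁻¹ ∈ e '' (K ×ˢ B₁) := by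
        obtain ⟨p, hp, hpx⟩ := hx
        refine ⟨p, hp, ?_⟩
        have hpx' : φ (e p) = x * φ (τ b) * x⁻¹ := hpx
        apply φ.injective
        rw [hpx', map_mul, map_mul, map_inv, φ.apply_symm_apply]
      obtain ⟨y, ⟨a, ha, rfl⟩, t, ht, hyt⟩ := Set.mem_mul.1 (hsat b hb (φ.symm x) hx')
      refine Set.mem_mul.2 ⟨φ (s a), ⟨a, ha, rfl⟩, φ t, (hT t).1 ht, ?_⟩
      have h1 : φ (s a * t) = x := by rw [hyt, φ.apply_symm_apply]
      rw [← map_mul, h1]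
    · intro b hb b' hb' y hy
      have hy' : φ.symm y * τ b * (φ.symm y)⁻¹ = τ b' := by
        apply φ.injective
        rw [map_mul, map_mul, map_inv, φ.apply_symm_apply, hy]
      have hmem : φ.symm y ∈ T := hsep b hb b' hb' (φ.symm y) hy'
      have h2 := (hT (φ.symm y)).1 hmem
      rwa [φ.apply_symm_apply] at h2

end Map

/-! ## §2 Re-coordinatisation of the torus factor -/

section Recoord

variable {A B B' G : Type*} [TopologicalSpace A] [TopologicalSpace B] [TopologicalSpace B'] [Group G] [TopologicalSpace G]

/-- **Re-coordinatisation of the torus factor of a slice datum.** If `κ : B ≃ₜ B′` and `τ′ ∘ κ = τ`, the slice datum `(e, s, τ)` with its box clause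
becomes the datum `(e′, s, τ′)` on `A × B′` with `e′(a, b′) = e(a, κ⁻¹ b′)`, base point `(a₀, κ b₀)`, boxes `K × κ(B₁)`; `T` unchanged.
[cite: BourbakiGT1, Ch. III §2] [cite: HarishChandra1970, Part II §5] -/
theorem exists_sliceDatum_recoord (κ : B ≃ₜ B') (s : A → G) (τ : B → G) (τ' : B' → G) (hττ' : ∀ b, τ' (κ b) = τ b)
    (e : OpenPartialHomeomorph (A × B) G) (he : ∀ p ∈ e.source, e p = s p.1 * τ p.2 * (s p.1)⁻¹)
    {a₀ : A} {b₀ : B} (T : Subgroup G)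
    (hbox : ∀ N ∈ 𝓝 (a₀, b₀), ∃ (K : Set A) (B₁ : Set B), IsCompact K ∧ IsOpen K ∧ a₀ ∈ K ∧ IsCompact B₁ ∧ IsOpen B₁ ∧ b₀ ∈ B₁ ∧
      K ×ˢ B₁ ⊆ N ∧ K ×ˢ B₁ ⊆ e.source ∧
      (∀ b ∈ B₁, ∀ x : G, x * τ b * x⁻¹ ∈ e '' (K ×ˢ B₁) → x ∈ s '' K * (T : Set G)) ∧
      (∀ b ∈ B₁, ∀ b' ∈ B₁, ∀ y : G, y * τ b * y⁻¹ = τ b' → y ∈ T)) :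
    ∃ e' : OpenPartialHomeomorph (A × B') G, (∀ p, p ∈ e'.source ↔ (p.1, κ.symm p.2) ∈ e.source) ∧
      (∀ p, e' p = e (p.1, κ.symm p.2)) ∧ (∀ p ∈ e'.source, e' p = s p.1 * τ' p.2 * (s p.1)⁻¹) ∧
      ∀ N ∈ 𝓝 (a₀, κ b₀), ∃ (K : Set A) (B₁ : Set B'), IsCompact K ∧ IsOpen K ∧ a₀ ∈ K ∧ IsCompact B₁ ∧ IsOpen B₁ ∧ κ b₀ ∈ B₁ ∧
        K ×ˢ B₁ ⊆ N ∧ K ×ˢ B₁ ⊆ e'.source ∧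
        (∀ b ∈ B₁, ∀ x : G, x * τ' b * x⁻¹ ∈ e' '' (K ×ˢ B₁) → x ∈ s '' K * (T : Set G)) ∧
        (∀ b ∈ B₁, ∀ b' ∈ B₁, ∀ y : G, y * τ' b * y⁻¹ = τ' b' → y ∈ T) := by
  have hτ'eq : ∀ b' : B', τ' b' = τ (κ.symm b') := fun b' => by rw [← hττ' (κ.symm b'), κ.apply_symm_apply]
  refine ⟨((Homeomorph.refl A).prodCongr κ.symm).transOpenPartialHomeomorph e, fun p => Iff.rfl, fun p => rfl, ?_, ?_⟩
  · intro p hp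
    have hp' : (p.1, κ.symm p.2) ∈ e.source := hp
    show e (p.1, κ.symm p.2) = _
    rw [he _ hp', hτ'eq]
  · intro N hN
    have hΘ : Continuous fun q : A × B => (q.1, κ q.2) := continuous_fst.prodMk (κ.continuous.comp continuous_snd)
    obtain ⟨K, B₁, hKc, hKo, haK, hB₁c, hB₁o, hbB, hKBN, hKBs, hsat, hsep⟩ := hbox _ (hΘ.continuousAt.preimage_mem_nhds hN)
    refine ⟨K, κ '' B₁, hKc, hKo, haK, hB₁c.image κ.continuous, κ.isOpenMap B₁ hB₁o, ⟨b₀, hbB, rfl⟩, ?_, ?_, ?_, ?_⟩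
    · rintro ⟨a, b'⟩ ⟨ha, ⟨b, hb, rfl⟩⟩
      exact hKBN (mk_mem_prod ha hb)
    · rintro ⟨a, b'⟩ ⟨ha, ⟨b, hb, rfl⟩⟩
      show (a, κ.symm (κ b)) ∈ e.source
      rw [κ.symm_apply_apply]
      exact hKBs (mk_mem_prod ha hb)
    · rintro b' ⟨b, hb, rfl⟩ x hx
      obtain ⟨⟨a, b''⟩, ⟨ha, ⟨b₂, hb₂, rfl⟩⟩, hpx⟩ := hx
      have hpx' : e (a, b₂) = x * τ b * x⁻¹ := by
        rw [← hττ' b, ← hpx]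
        show e (a, b₂) = e (a, κ.symm (κ b₂))
        rw [κ.symm_apply_apply]
      exact hsat b hb x ⟨(a, b₂), mk_mem_prod ha hb₂, hpx'⟩
    · rintro b' ⟨b, hb, rfl⟩ b'' ⟨b₂, hb₂, rfl⟩ y h
      rw [hττ', hττ'] at h
      exact hsep b hb b₂ hb₂ y h

end Recoord

/-! ## §3 The subgroup form and the centraliser form -/

section Subgroup

variable {A G G' : Type*} [TopologicalSpace A] [Group G] [TopologicalSpace G] [Group G'] [TopologicalSpace G']

/-- **(m1) SLICE DATUM TRANSPORT ALONG `φ : G ≃ₜ* G′`, SUBGROUP FORM.** A slice datum on `A × ↥T` around `(a₀, t₀)` with its (SAT)∕(SEP′) box clause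
with respect to `T` yields, for any `T′ ≤ G′` with `g ∈ T ↔ φ g ∈ T′`, a slice datum on `A × ↥T′` around `(a₀, t₀′)`, `t₀′ = φ t₀`, with slice `φ ∘ s`,
`e′(a, t′) = φ(s a)·t′·φ(s a)⁻¹`, and the same box clause with respect to `T′`. [cite: HarishChandra1970, Part II §5] [cite: BourbakiGT1, Ch. III §2] -/
theorem exists_sliceDatum_transport (φ : G ≃ₜ* G') (T : Subgroup G) (T' : Subgroup G') (hT : ∀ g, g ∈ T ↔ φ g ∈ T')
    (s : A → G) (e : OpenPartialHomeomorph (A × ↥T) G) (he : ∀ p ∈ e.source, e p = s p.1 * (p.2 : G) * (s p.1)⁻¹)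
    {a₀ : A} {t₀ : ↥T} (h₀ : (a₀, t₀) ∈ e.source)
    (hbox : ∀ N ∈ 𝓝 (a₀, t₀), ∃ (K : Set A) (B₁ : Set ↥T), IsCompact K ∧ IsOpen K ∧ a₀ ∈ K ∧ IsCompact B₁ ∧ IsOpen B₁ ∧ t₀ ∈ B₁ ∧
      K ×ˢ B₁ ⊆ N ∧ K ×ˢ B₁ ⊆ e.source ∧
      (∀ t ∈ B₁, ∀ x : G, x * (t : G) * x⁻¹ ∈ e '' (K ×ˢ B₁) → x ∈ s '' K * (T : Set G)) ∧
      (∀ t ∈ B₁, ∀ t' ∈ B₁, ∀ y : G, y * (t : G) * y⁻¹ = (t' : G) → y ∈ T)) :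
    ∃ (e' : OpenPartialHomeomorph (A × ↥T') G') (t₀' : ↥T'), (t₀' : G') = φ t₀ ∧ (a₀, t₀') ∈ e'.source ∧
      (∀ p ∈ e'.source, e' p = φ (s p.1) * (p.2 : G') * (φ (s p.1))⁻¹) ∧
      ∀ N ∈ 𝓝 (a₀, t₀'), ∃ (K : Set A) (B₁ : Set ↥T'), IsCompact K ∧ IsOpen K ∧ a₀ ∈ K ∧ IsCompact B₁ ∧ IsOpen B₁ ∧ t₀' ∈ B₁ ∧
        K ×ˢ B₁ ⊆ N ∧ K ×ˢ B₁ ⊆ e'.source ∧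
        (∀ t ∈ B₁, ∀ x : G', x * (t : G') * x⁻¹ ∈ e' '' (K ×ˢ B₁) → x ∈ (fun a => φ (s a)) '' K * (T' : Set G')) ∧
        (∀ t ∈ B₁, ∀ t' ∈ B₁, ∀ y : G', y * (t : G') * y⁻¹ = (t' : G') → y ∈ T') := by
  -- the restriction `κ = φ|_T : ↥T ≃ₜ ↥T′`
  let κ : ↥T ≃ₜ ↥T' :=
    { toFun := fun t => ⟨φ t, (hT t).1 t.2⟩
      invFun := fun t' => ⟨φ.symm t', (hT _).2 (by rw [φ.apply_symm_apply]; exact t'.2)⟩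
      left_inv := fun t => Subtype.ext (φ.symm_apply_apply t)
      right_inv := fun t' => Subtype.ext (φ.apply_symm_apply t')
      continuous_toFun := (φ.continuous.comp continuous_subtype_val).subtype_mk _
      continuous_invFun := (φ.symm.continuous.comp continuous_subtype_val).subtype_mk _ }
  have hκ : ∀ t : ↥T, ((κ t : ↥T') : G') = φ t := fun t => rfl
  -- §1: transport along `φ`, torus coordinate still `↥T`
  obtain ⟨e₁, he₁src, -, he₁, hbox₁⟩ :=
    exists_sliceDatum_map φ T T' hT s (fun t : ↥T => (t : G)) e he hbox
  -- §2: re-coordinatise `↥T` onto `↥T′` along `κ`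
  obtain ⟨e₂, he₂src, -, he₂, hbox₂⟩ :=
    exists_sliceDatum_recoord κ (fun a => φ (s a)) (fun t : ↥T => φ (t : G)) (fun t' : ↥T' => (t' : G')) hκ e₁ he₁ T' hbox₁
  refine ⟨e₂, κ t₀, hκ t₀, ?_, he₂, hbox₂⟩
  refine (he₂src _).2 ?_
  show (a₀, κ.symm (κ t₀)) ∈ e₁.source
  rw [κ.symm_apply_apply, he₁src]
  exact h₀

/-- **(m1) SLICE DATUM TRANSPORT ALONG `φ : G ≃ₜ* G′`, CENTRALISER FORM** (the token shape of `exists_unitary_sliceDatum`'s conclusion). A slice datum on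
`A × ↥Z_G(γ)` around `(a₀, t₀)` with its (SAT)∕(SEP′) box clause with respect to `Z_G(γ)` yields, for `γ′ = φ γ`, a slice datum on `A × ↥Z_{G′}(γ′)` around
`(a₀, t₀′)`, `t₀′ = φ t₀`, slice `φ ∘ s`, `e′(a, t′) = φ(s a)·t′·φ(s a)⁻¹`, with the same box clause with respect to `Z_{G′}(γ′)`. The CM dress applies it with
`φ := (localNonsplitEquiv …).symm`. [cite: HarishChandra1970, Part II §5] [cite: Rogawski1990, §8.2 Prop. 8.2.1 p. 112] [cite: BourbakiGT1, Ch. III §2] -/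
theorem exists_sliceDatum_transport_centralizer (φ : G ≃ₜ* G') (s : A → G) (γ : G) (γ' : G') (hγ' : φ γ = γ')
    (e : OpenPartialHomeomorph (A × ↥(Subgroup.centralizer ({γ} : Set G))) G)
    (he : ∀ p ∈ e.source, e p = s p.1 * (p.2 : G) * (s p.1)⁻¹)
    {a₀ : A} {t₀ : ↥(Subgroup.centralizer ({γ} : Set G))} (h₀ : (a₀, t₀) ∈ e.source)
    (hbox : ∀ N ∈ 𝓝 (a₀, t₀), ∃ (K : Set A) (B₁ : Set ↥(Subgroup.centralizer ({γ} : Set G))),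
      IsCompact K ∧ IsOpen K ∧ a₀ ∈ K ∧ IsCompact B₁ ∧ IsOpen B₁ ∧ t₀ ∈ B₁ ∧ K ×ˢ B₁ ⊆ N ∧ K ×ˢ B₁ ⊆ e.source ∧
      (∀ t ∈ B₁, ∀ x : G, x * (t : G) * x⁻¹ ∈ e '' (K ×ˢ B₁) → x ∈ s '' K * (Subgroup.centralizer ({γ} : Set G) : Set G)) ∧
      (∀ t ∈ B₁, ∀ t' ∈ B₁, ∀ y : G, y * (t : G) * y⁻¹ = (t' : G) → y ∈ Subgroup.centralizer ({γ} : Set G))) :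
    ∃ (e' : OpenPartialHomeomorph (A × ↥(Subgroup.centralizer ({γ'} : Set G'))) G') (t₀' : ↥(Subgroup.centralizer ({γ'} : Set G'))),
      (t₀' : G') = φ t₀ ∧ (a₀, t₀') ∈ e'.source ∧
      (∀ p ∈ e'.source, e' p = φ (s p.1) * (p.2 : G') * (φ (s p.1))⁻¹) ∧
      ∀ N ∈ 𝓝 (a₀, t₀'), ∃ (K : Set A) (B₁ : Set ↥(Subgroup.centralizer ({γ'} : Set G'))),
        IsCompact K ∧ IsOpen K ∧ a₀ ∈ K ∧ IsCompact B₁ ∧ IsOpen B₁ ∧ t₀' ∈ B₁ ∧ K ×ˢ B₁ ⊆ N ∧ K ×ˢ B₁ ⊆ e'.source ∧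
        (∀ t ∈ B₁, ∀ x : G', x * (t : G') * x⁻¹ ∈ e' '' (K ×ˢ B₁) →
          x ∈ (fun a => φ (s a)) '' K * (Subgroup.centralizer ({γ'} : Set G') : Set G')) ∧
        (∀ t ∈ B₁, ∀ t' ∈ B₁, ∀ y : G', y * (t : G') * y⁻¹ = (t' : G') → y ∈ Subgroup.centralizer ({γ'} : Set G')) := by
  subst hγ'
  have hT : ∀ g : G, g ∈ Subgroup.centralizer ({γ} : Set G) ↔ φ g ∈ Subgroup.centralizer ({φ γ} : Set G') := fun g => by
    rw [Subgroup.mem_centralizer_singleton_iff, Subgroup.mem_centralizer_singleton_iff, ← map_mul, ← map_mul]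
    exact ⟨fun h => by rw [h], fun h => φ.injective h⟩
  exact exists_sliceDatum_transport φ _ _ hT s e he h₀ hbox

end Subgroup

end Literature.NumberTheory.Automorphic
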